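import Mathlib
import Summits.ResolutionOfSingularities.ResolutionOfSingularities.Theorems.RadicialJungCleanModelsCleanProp44CrossInsertion
import HarnessLib

/-!
# Route `RadicialJung`, crux `CleanModels` (stmt-ResolutionOfSingularities-15917), line `Sketch` rev 35, stub 6 `stub_cleanProp44` (X44c):
# THE BIRTH CHAIN STEP — insertion at a birth with an arbitrary `p`-th power factor (composable form)

Seat decomp-res-hand-2 g19 (structural hand); sequel of ✓ `…CleanProp44CrossInsertion.lean`.  After a vertex insertion (✓ `…VertexInsertion{,Unit}.lean`) the
transform at the new point is `U · ε^{a} · E^{S}`; when this is a birth (`p ∣ a`, `p ∣ S`) the NEXT insertion must be read from a representative of the shape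
`U · e^A · D^p` (`e := ε`, `A := a`, `D := E^{S/p}`; the side `E` is transversal to the curve and never obstructs).  ✓ `cleanPermissibleAt_strictTransform_of_unitForm_or_birth`
asked for `U · e^A` exactly; here is the COMPOSABLE form with an arbitrary non-zero `p`-th power factor, so that the theorem iterates along a chain of births
with ONE unit `U` pulled back step by step:

* `cleanPermissibleAt_strictTransform_of_unitForm_mul_pow_or_birth` — `x` with `(e, y, z) = 𝔪_x`, `N = (e, y)`, a non-trivial representative
  `U · e^A · D^p` (`U` a unit, `D ≠ 0`); blow up `x`; at `x'` on the strict transforms of `V(e)`, `V(y)` (`σ^♯ e = E ε`, `σ^♯ y = E ζ`): `(E, ε, ζ) = 𝔪_{x'}`,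
  the SAME representative reads `σ^♯ U · ε^A · E^A · (σ^♯ D)^p`, and `N' = (ε, ζ)` is clean-permissible at `x'` unless `p ∣ A` and `σ^♯ U` fails the
  non-birth test for `N'`.
* `cleanPermissibleAt_strictTransform_of_unitForm_mul_pow_or_birth_next` — the output re-packaged as an input of the same theorem at `x'`: when `p ∣ A`, the
  representative is `σ^♯ U · ε^0 · D'^p` with `D' = ε^{A/p} · E^{A/p} · σ^♯ D ≠ 0` against the regular system `(ε, ζ, E)` — ready for the next insertion.

Honest framing: OURS, bookkeeping; the descent of the birth defect of `U` along the chain (memo 4e §2.5–2.6) is NOT here.  Nothing here proves X44c, any case of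
`CleanModels`, or resolution of singularities in characteristic `p`.  Setting only: [cite: CossartPiltant2008, Lemma 4.3 (5); Prop. 4.4 (proof, p. 11)]
[cite: Piltant2013, §2 Axiom 4].
-/

noncomputable section

set_option linter.dupNamespace false -- mandated namespace of this single-conjunct summit

open IsLocalRing CategoryTheory AlgebraicGeometry
open Literature.AlgebraicGeometry.Resolution Literature.AlgebraicGeometry.Motives

namespace Summit.ResolutionOfSingularities.ResolutionOfSingularities.Theorems.RadicialJung.CleanModels

universe u

section Scheme

variable {p : ℕ} {X X' : Scheme.{u}} [IsIntegral X] [IsIntegral X'] {σ : X' ⟶ X} [IsDominant σ] {J : X.IdealSheafData}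

set_option maxHeartbeats 1600000 in
-- absorb the `p`-th power, apply the cross-insertion theorem, recompute the transform
/-- **THE BIRTH CHAIN STEP (composable form).**  See the module docstring. [cite: CossartPiltant2008, Lemma 4.3 (5); Prop. 4.4 (proof, p. 11)]
[cite: Piltant2013, §2 Axiom 4] -/
theorem cleanPermissibleAt_strictTransform_of_unitForm_mul_pow_or_birth [Fact p.Prime] [CharP X.functionField p] [CharP X'.functionField p]
    (hσ : IsBlowup σ J) (x' : X') (hR : IsRegularLocalRing (X.presheaf.stalk (σ x'))) (hdim : ringKrullDim (X.presheaf.stalk (σ x')) = (3 : ℕ))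
    (hJ : stalkIdeal J (σ x') = maximalIdeal (X.presheaf.stalk (σ x'))) {e y z : X.presheaf.stalk (σ x')}
    (hzz : Ideal.span ({e, y, z} : Set (X.presheaf.stalk (σ x'))) = maximalIdeal (X.presheaf.stalk (σ x')))
    {G : X.functionField} {cc : Fin p → X.functionField} (hcc : ∃ j : Fin p, (j : ℕ) ≠ 0 ∧ cc j ≠ 0)
    {U : X.presheaf.stalk (σ x')} (hU : IsUnit U) (A : ℕ) {D : X.presheaf.stalk (σ x')} (hD : D ≠ 0)
    (hrep : (∑ j : Fin p, cc j ^ p * G ^ (j : ℕ)) = RatFn.toFunctionField (σ x') (U * e ^ A * D ^ p))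
    (hdim' : ringKrullDim (X'.presheaf.stalk x') = 3) {E ε ζ : X'.presheaf.stalk x'}
    (hE : Ideal.span {E} = (maximalIdeal (X.presheaf.stalk (σ x'))).map (σ.stalkMap x').hom)
    (hε : (σ.stalkMap x').hom e = E * ε) (hεm : ε ∈ maximalIdeal (X'.presheaf.stalk x'))
    (hζ : (σ.stalkMap x').hom y = E * ζ) (hζm : ζ ∈ maximalIdeal (X'.presheaf.stalk x')) :
    Ideal.span ({E, ε, ζ} : Set (X'.presheaf.stalk x')) = maximalIdeal (X'.presheaf.stalk x') ∧
    (∑ j : Fin p, RatFn.functionFieldMap σ (cc j) ^ p * RatFn.functionFieldMap σ G ^ (j : ℕ)) =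
      RatFn.toFunctionField x' ((σ.stalkMap x').hom U * ε ^ A * E ^ A * (σ.stalkMap x').hom D ^ p) ∧
    (CleanPermissibleAt p (RatFn.toFunctionField x') (RatFn.functionFieldMap σ G) (Ideal.span ({ε, ζ} : Set (X'.presheaf.stalk x'))) ∨
      (p ∣ A ∧
        ¬ ((∀ c' : X'.presheaf.stalk x', (σ.stalkMap x').hom U - c' ^ p ∉ maximalIdeal (X'.presheaf.stalk x')) ∨
          (∃ c' : X'.presheaf.stalk x', (σ.stalkMap x').hom U - c' ^ p ∈ maximalIdeal (X'.presheaf.stalk x') ∧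
            (σ.stalkMap x').hom U - c' ^ p ∉ Ideal.span ({ε, ζ} : Set (X'.presheaf.stalk x')) ⊔ maximalIdeal (X'.presheaf.stalk x') ^ 2) ∨
          (∃ c' : X'.presheaf.stalk x', (σ.stalkMap x').hom U - c' ^ p ∈ Ideal.span ({ε, ζ} : Set (X'.presheaf.stalk x')) ∧
            (σ.stalkMap x').hom U - c' ^ p ∉ maximalIdeal (X'.presheaf.stalk x') ^ 2)))) := by
  classical
  -- absorb the `p`-th power factor into the representative
  have hDK : RatFn.toFunctionField (σ x') D ≠ 0 := (map_ne_zero_iff _ (RatFn.toFunctionField_injective (σ x'))).mpr hD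
  have hrepD : (∑ j : Fin p, cc j ^ p * G ^ (j : ℕ)) =
      RatFn.toFunctionField (σ x') (U * e ^ A) * RatFn.toFunctionField (σ x') D ^ p := by
    rw [hrep, map_mul, map_pow]
  obtain ⟨cc', hcc', hrep'⟩ := exists_rep_of_rep_eq_mul_pow p G cc hcc hDK hrepD
  obtain ⟨htriple, -, hdisj⟩ :=
    cleanPermissibleAt_strictTransform_of_unitForm_or_birth hσ x' hR hdim hJ hzz hcc' hU A hrep' hdim' hE hε hεm hζ hζm
  refine ⟨htriple, ?_, hdisj⟩
  -- the transform of the original representative, computed directly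
  obtain ⟨-, hrepσ⟩ := rep_functionFieldMap x' hcc hrep
  have hσeq : (σ.stalkMap x').hom (U * e ^ A * D ^ p) = (σ.stalkMap x').hom U * ε ^ A * E ^ A * (σ.stalkMap x').hom D ^ p := by
    rw [map_mul, map_mul, map_pow, map_pow, hε, mul_pow]
    ring
  rw [hrepσ, hσeq]

/-- **The output of the birth chain step is an input of the same step** (when `p ∣ A`): at `x'` the representative reads `σ^♯ U · ε^0 · D'^p` with
`D' = ε^{A/p} · E^{A/p} · σ^♯ D ≠ 0`, against the regular system `(ε, ζ, E)` of `𝒪_{X',x'}` — so the theorem above applies VERBATIM to the next insertion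
(at `x'`, for the curve `N' = (ε, ζ)`), with the same unit pulled back once more. [cite: CossartPiltant2008, Lemma 4.3 (5)] [cite: Piltant2013, §2 Axiom 4] -/
theorem cleanPermissibleAt_strictTransform_of_unitForm_mul_pow_or_birth_next [Fact p.Prime] [CharP X.functionField p] [CharP X'.functionField p]
    (hσ : IsBlowup σ J) (x' : X') (hR : IsRegularLocalRing (X.presheaf.stalk (σ x'))) (hdim : ringKrullDim (X.presheaf.stalk (σ x')) = (3 : ℕ))
    (hJ : stalkIdeal J (σ x') = maximalIdeal (X.presheaf.stalk (σ x'))) {e y z : X.presheaf.stalk (σ x')}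
    (hzz : Ideal.span ({e, y, z} : Set (X.presheaf.stalk (σ x'))) = maximalIdeal (X.presheaf.stalk (σ x')))
    {G : X.functionField} {cc : Fin p → X.functionField} (hcc : ∃ j : Fin p, (j : ℕ) ≠ 0 ∧ cc j ≠ 0)
    {U : X.presheaf.stalk (σ x')} (hU : IsUnit U) {A : ℕ} (hA : p ∣ A) {D : X.presheaf.stalk (σ x')} (hD : D ≠ 0)
    (hrep : (∑ j : Fin p, cc j ^ p * G ^ (j : ℕ)) = RatFn.toFunctionField (σ x') (U * e ^ A * D ^ p))
    (hdim' : ringKrullDim (X'.presheaf.stalk x') = 3) {E ε ζ : X'.presheaf.stalk x'}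
    (hE : Ideal.span {E} = (maximalIdeal (X.presheaf.stalk (σ x'))).map (σ.stalkMap x').hom)
    (hε : (σ.stalkMap x').hom e = E * ε) (hεm : ε ∈ maximalIdeal (X'.presheaf.stalk x'))
    (hζ : (σ.stalkMap x').hom y = E * ζ) (hζm : ζ ∈ maximalIdeal (X'.presheaf.stalk x')) :
    Ideal.span ({ε, ζ, E} : Set (X'.presheaf.stalk x')) = maximalIdeal (X'.presheaf.stalk x') ∧
    IsUnit ((σ.stalkMap x').hom U) ∧ ε ^ (A / p) * E ^ (A / p) * (σ.stalkMap x').hom D ≠ 0 ∧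
    (∑ j : Fin p, RatFn.functionFieldMap σ (cc j) ^ p * RatFn.functionFieldMap σ G ^ (j : ℕ)) =
      RatFn.toFunctionField x' ((σ.stalkMap x').hom U * ε ^ 0 * (ε ^ (A / p) * E ^ (A / p) * (σ.stalkMap x').hom D) ^ p) := by
  classical
  obtain ⟨htriple, hrepσ, -⟩ := cleanPermissibleAt_strictTransform_of_unitForm_mul_pow_or_birth hσ x' hR hdim hJ hzz hcc hU A hD hrep hdim'
    hE hε hεm hζ hζm
  -- `𝒪_{X',x'}` is regular (a generating triple in dimension `3`), hence a domain
  have hdim0 : ringKrullDim (X.presheaf.stalk (σ x')) = ((3 + 0 : ℕ) : WithBot ℕ∞) := by rw [Nat.add_zero]; exact hdim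
  have hc : Ideal.span (Set.range (![z, y + z, e] : Fin 3 → X.presheaf.stalk (σ x'))) = maximalIdeal (X.presheaf.stalk (σ x')) := by
    rw [← hzz, ← span_triple_shear_eq e y z]
    congr 1
    ext t
    simp only [Set.mem_range, Set.mem_insert_iff, Set.mem_singleton_iff]
    constructor
    · rintro ⟨j, rfl⟩
      fin_cases j <;> simp
    · rintro (rfl | rfl | rfl)
      exacts [⟨0, rfl⟩, ⟨1, rfl⟩, ⟨2, rfl⟩]
  have hz0 : Ideal.span (Set.range (Fin.append (![z, y + z, e] : Fin 3 → X.presheaf.stalk (σ x')) Fin.elim0)) =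
      maximalIdeal (X.presheaf.stalk (σ x')) := by rw [span_range_append_elim0_eq, hc]
  obtain ⟨_, _, _, _, -, -, -, -, -, hrsop, -⟩ :=
    exists_transform_normalForm_of_isBlowup hσ x' hR _ Fin.elim0 hz0 hdim0 (hc.trans hJ.symm) (fun _ => 0) Fin.elim0 isUnit_one
  have hR' : IsRegularLocalRing (X'.presheaf.stalk x') := hrsop.isRegularLocalRing
  haveI := isDomain_of_isRegularLocalRing (X'.presheaf.stalk x')
  have h3 := isRsopPart_vecCons_three_of_span_triple hR' hdim' htriple
  have hE0 : E ≠ 0 := by simpa using h3.ne_zero 0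
  have hε0 : ε ≠ 0 := by simpa using h3.ne_zero 1
  have hσD : (σ.stalkMap x').hom D ≠ 0 := by
    intro h0
    have h1 := (map_ne_zero_iff _ (RatFn.toFunctionField_injective x')).mpr hE0
    -- `σ^♯` is injective on stalks of a dominant morphism of integral schemes: read in the function field
    have h2 : RatFn.toFunctionField x' ((σ.stalkMap x').hom D) = RatFn.functionFieldMap σ (RatFn.toFunctionField (σ x') D) := by
      rw [RatFn.functionFieldMap_toFunctionField]
    have h3' : RatFn.functionFieldMap σ (RatFn.toFunctionField (σ x') D) = 0 := by rw [← h2, h0, map_zero]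
    exact ((map_ne_zero_iff _ (RatFn.functionFieldMap σ).injective).mpr
      ((map_ne_zero_iff _ (RatFn.toFunctionField_injective (σ x'))).mpr hD)) h3'
  have hzz' : Ideal.span ({ε, ζ, E} : Set (X'.presheaf.stalk x')) = maximalIdeal (X'.presheaf.stalk x') := by
    rw [← htriple]
    congr 1
    ext t
    simp only [Set.mem_insert_iff, Set.mem_singleton_iff]
    tauto
  refine ⟨hzz', hU.map _, mul_ne_zero (mul_ne_zero (pow_ne_zero _ hε0) (pow_ne_zero _ hE0)) hσD, ?_⟩
  rw [hrepσ, pow_zero, mul_one, mul_pow, mul_pow, ← pow_mul, ← pow_mul, Nat.div_mul_cancel hA]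
  congr 1
  ring

end Scheme

end Summit.ResolutionOfSingularities.ResolutionOfSingularities.Theorems.RadicialJung.CleanModels

end
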